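import Literature.NumberTheory.Automorphic.Liu2021.Def411WeilCarriersCentralTypeRigidity
import Literature.NumberTheory.Automorphic.UnitaryGroupAdelicCharactersArchTypeTwist
import HarnessLib

/-!
# Rigidity along the splitting dictionary, weight-one reading: same central type ⇒ `μ` of weight one with `Φ_μ = Φ`

Topic `NumberTheory/Automorphic/Liu2021`; namespace `Literature.NumberTheory.Automorphic.Liu2021.Def411WeilCarriersDoubling`.
KERNEL only: proved theorems; no definition, no named fact, no `sorry`.  SEQUEL of `Def411WeilCarriersCentralTypeRigidity`
(pin side: equal archimedean central characters on one non-zero vector force the twisting character `α` of `s = ι_{χ₀·α̃}` to be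
trivial on `U(1)(L⁺ ⊗ ℝ)`) composed with `UnitaryGroupAdelicCharactersArchTypeTwist` (character side, seat item6-p3: the class
character `μ₀ ⊛ α = [toHecke μ₀ · α̃]` of a twist with `α_∞ = 1` keeps the ∞-type, the weight and the CM type of `μ₀`).

* `exists_eq_chiSplittingLine_twist_of_center_eq` — for a CONJUGATE SYMPLECTIC class character `μ₀` [Liu2021, Def. 4.1] (base point
  `χ₀ := toHeckeCharacter μ₀` of the dictionary) and a continuous compatible `s` of the line datum with the SAME archimedean central
  character as `ι_{χ₀}` on one `Φ₀ ≠ 0`: `s = ι_{toHecke(μ₀ ⊛ α)}` with `α = 1` on `U(1)(L⁺ ⊗ ℝ)`, `μ₀ ⊛ α` conjugate symplectic of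
  the ∞-type of `μ₀`;
* `exists_eq_chiSplittingLine_twist_weightOne_of_center_eq` — if moreover `μ₀` has WEIGHT ONE and CM type `Φ` [Liu2021, Def. 4.3],
  then so does `μ := μ₀ ⊛ α`: `HasWeight L μ 1`, `Φ_μ = Φ` — Liu's hypotheses on `μ` in [Liu2021, Thm. 4.18] for the line of `s`.

Consequence for the Δ2 bridge of the Hodge-CM cells (X3-Char item (E) = MODEL-N row N-i1-match): at a Gram class `q`, ONE dictionary
member `ι_{toHecke μ_q}` of the central-type fibre with `μ_q` of weight one and `Φ_{μ_q} = Φ^δ(q)` makes EVERY continuous member of the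
fibre an `ι_μ` with `μ` of weight one and `Φ_μ = Φ^δ(q)`; the residual analytic input is that one reference central character
([KonnoKonno2007, Lem. 5.2] ∕ [Liu2021, Lem. D.2] territory, not computed here).  HC_CM is NOT proved here or anywhere in the tree.
References: S. Gelbart, J. Rogawski, Invent. Math. 105 (1991), §3.1 Remark p. 457 L4–13 [GelbartRogawski1991]; Y. Liu, Camb. J.
Math. 9 (2021), §4.1 Def. 4.1, Def. 4.3, Remark 4.2, App. D §D.1 Step 2, Thm. 4.18 [Liu2021].
Provenance: pub-hodgecm2 (COR-CM), seat pin-3, X3-Char residual item (E).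
-/

set_option autoImplicit false

noncomputable section

open scoped Classical
open scoped Matrix Kronecker TensorProduct
open NumberField NumberField.InfinitePlace IsDedekindDomain
open Literature.RepresentationTheory.HeisenbergGroup
open Literature.NumberTheory.Weil1964
open Literature.RepresentationTheory.HarrisKudlaSweet1996
open Literature.NumberTheory.Automorphic
open Literature.NumberTheory.GaloisRepresentations

namespace Literature.NumberTheory.Automorphic.Liu2021.Def411WeilCarriersDoubling

open Literature.NumberTheory.GelbartRogawski1991 Literature.NumberTheory.GelbartRogawski1991.UnitaryDualPair
open Literature.NumberTheory.GelbartRogawski1991.GRConstruction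
open Literature.NumberTheory.GelbartRogawski1991.GRConstruction.DoubledWeilDetTwist
open Literature.NumberTheory.Automorphic.UnitaryGroup.AdelicCharactersArchType
open Literature.NumberTheory.Automorphic.IdeleClassGroup

variable (L : Type) [Field L] [NumberField L] [IsCMField L]

local notation3 "L⁺" => maximalRealSubfield L

section General

variable {N' n' : ℕ} (e₁ : Fin N' × Fin 1 ≃ Fin n')
  (dV₁ : Fin N' → L) (hdV₁ : ∀ i, IsCMField.complexConj L (dV₁ i) = dV₁ i) (hdV₁0 : ∀ i, dV₁ i ≠ 0)
  (TW : Matrix (Fin 1) (Fin 1) (Fp L)) (hW : TW.IsSymm) (hWd : IsUnit TW.det) (JW : Matrix (Fin 1) (Fin 1) L)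
  (hJW : JW = TW.map (algebraMap (Fp L) L))
  (hA : CentralCharFactorsThroughDet (Fp L) L (IsCMField.complexConj L) N' 1 e₁ (Matrix.diagonal dV₁) JW
    (det_reindex_kronecker_diagonal_line_ne_zero L e₁ dV₁ hdV₁0 TW hWd JW hJW))
  (μ₀ : IdeleClassGroup L →ₜ* Circle) (hμ₀ : IsConjugateSymplectic L μ₀)
  {s : UnitaryGroup.adelicPair (Fp L) L (IsCMField.complexConj L) N' 1 (Matrix.diagonal dV₁) JW →*
    adelicMpCont (Fp L) (Fin n') (adelicGram (Fp L) e₁ (realDiagonal L dV₁ hdV₁) TW)}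
  (hsc : Continuous s)
  (hs : (splittingDatum (Fp L) L (IsCMField.complexConj L) N' 1 e₁ (Matrix.diagonal dV₁) JW
      (complexConj_imagUnit L) (imagUnit_ne_zero L) (imagUnit_mul_self L) (realDiagonal_isSymm L dV₁ hdV₁) hW
      (isUnit_det_realDiagonal L dV₁ hdV₁ hdV₁0) hWd (realDiagonal_map L dV₁ hdV₁).symm hJW).IsCompatible s)
  {Φ₀ : piSchwartzBruhat (Fp L) (Fin n')} (hΦ₀ : Φ₀ ≠ 0)

include hμ₀ in
/-- the base point `χ₀ := toHeckeCharacter μ₀` of a conjugate symplectic class character is a unitary splitting character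
for `m = 1` ([HarrisKudlaSweet1996] (1.5) ⟺ [Liu2021] Def. 4.1). [cite: Liu2021, Definition 4.1] [cite: HarrisKudlaSweet1996, §1 (1.5) p. 951] -/
theorem isSplittingChar_toHeckeCharacter_of_isConjugateSymplectic :
    IsSplittingChar L 1 (toHeckeCharacter L μ₀) :=
  (isSplittingChar_toHeckeCharacter_iff_isConjugateSymplectic odd_one μ₀).2 hμ₀

include hdV₁0 hA hsc hs hΦ₀ in
set_option maxHeartbeats 2000000 in
/-- **Same central type ⇒ same ∞-type, in class currency.**  For a conjugate symplectic `μ₀` (dictionary base point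
`χ₀ := toHeckeCharacter μ₀`) and a continuous compatible `s` of the line datum: if the archimedean centre `(t · 1_V, 1)` acts
through `ι_{χ₀}` and through `s` on ONE `Φ₀ ≠ 0` by the SAME character `archWeight L m`, then `s = ι_{χ₀ · α̃}` for a continuous
unitary automorphic `α` with `α = 1` on `U(1)(L⁺ ⊗ ℝ)`; the class character `μ₀ ⊛ α` (`toHeckeCharacter (μ₀ ⊛ α) = χ₀ · α̃`) is
conjugate symplectic and has every ∞-type of `μ₀`.
[cite: GelbartRogawski1991, §3.1 Remark p. 457 L4–13] [cite: Liu2021, Definition 4.1] [cite: Liu2021, Remark 4.2] -/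
theorem exists_eq_chiSplittingLine_twist_of_center_eq [NeZero N'] {m : InfinitePlace L → ℤ}
    (h₀ : ∀ t, pairRep (Fp L) L (IsCMField.complexConj L) N' 1 e₁ (Matrix.diagonal dV₁) JW
        (chiSplittingLine L e₁ dV₁ hdV₁ hdV₁0 (toHeckeCharacter L μ₀) (isUnitary_toHeckeCharacter L μ₀)
          (isSplittingChar_toHeckeCharacter_of_isConjugateSymplectic L μ₀ hμ₀) TW hWd JW hJW)
        (CMCenter L dV₁ (archUnit L t), 1) Φ₀ = archWeight L m t • Φ₀)
    (h : ∀ t, pairRep (Fp L) L (IsCMField.complexConj L) N' 1 e₁ (Matrix.diagonal dV₁) JW s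
        (CMCenter L dV₁ (archUnit L t), 1) Φ₀ = archWeight L m t • Φ₀) :
    ∃ (α : CMAdelicOne L →* ℂˣ) (hα : Continuous α)
      (hαrat : ∀ u : CMAdelicOne L, (u : ideleGroup L) ∈ principalIdeles L → α u = 1)
      (hαu : ∀ u, ‖((α u : ℂˣ) : ℂ)‖ = 1),
      s = chiSplittingLine L e₁ dV₁ hdV₁ hdV₁0 (toHeckeCharacter L μ₀ * ratioHecke L α hα hαrat)
            (isUnitary_mul_ratioHecke L (isUnitary_toHeckeCharacter L μ₀) hα hαrat hαu)
            ((isSplittingChar_mul_ratioHecke_iff L 1 _ hα hαrat).2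
              (isSplittingChar_toHeckeCharacter_of_isConjugateSymplectic L μ₀ hμ₀)) TW hWd JW hJW ∧
        (∀ t, α (archUnit L t) = 1) ∧
        toHeckeCharacter L (twist L α hα hαrat μ₀) = toHeckeCharacter L μ₀ * ratioHecke L α hα hαrat ∧
        IsConjugateSymplectic L (twist L α hα hαrat μ₀) ∧
        ∀ e₀ : InfinitePlace L → ℤ, HasInfinityType L μ₀ e₀ → HasInfinityType L (twist L α hα hαrat μ₀) e₀ := by
  obtain ⟨α, hα, hαrat, hαu, hsα, h1⟩ := exists_eq_chiSplittingLine_archTrivial_of_center_eq L e₁ dV₁ hdV₁ hdV₁0 TW hW hWd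
    JW hJW hA (toHeckeCharacter L μ₀) (isUnitary_toHeckeCharacter L μ₀)
    (isSplittingChar_toHeckeCharacter_of_isConjugateSymplectic L μ₀ hμ₀) hsc hs hΦ₀ h₀ h
  exact ⟨α, hα, hαrat, hαu, hsα, h1, toHeckeCharacter_twist L α hα hαrat μ₀,
    (isConjugateSymplectic_twist_iff L α hα hαrat μ₀).2 hμ₀,
    fun e₀ he₀ => hasInfinityType_twist_of_arch_eq_one L α hα hαrat μ₀ he₀ h1⟩

include hdV₁0 hA hsc hs hΦ₀ in
set_option maxHeartbeats 2000000 in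
/-- **THE (E)-REDUCTION AT A CENTRAL-TYPE FIBRE, weight-one form.**  If the base point `μ₀` is conjugate symplectic OF WEIGHT ONE
with CM type `Φ` [Liu2021, Def. 4.3] and the archimedean centre acts through `ι_{toHecke μ₀}` and through the continuous compatible
`s` by the SAME character on one `Φ₀ ≠ 0`, then `s = ι_{toHecke μ}` for `μ := μ₀ ⊛ α` conjugate symplectic OF WEIGHT ONE with
`Φ_μ = Φ` — exactly the hypotheses on `μ` of [Liu2021, Thm. 4.18] for the line of `s`.
[cite: Liu2021, Definition 4.3] [cite: Liu2021, Definition 4.1] [cite: GelbartRogawski1991, §3.1 Remark p. 457 L4–13] -/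
theorem exists_eq_chiSplittingLine_twist_weightOne_of_center_eq [NeZero N'] (hw : HasWeight L μ₀ 1)
    {Φ : Literature.AlgebraicGeometry.Motives.CMType L} (hΦ : HasCMType L μ₀ Φ) {m : InfinitePlace L → ℤ}
    (h₀ : ∀ t, pairRep (Fp L) L (IsCMField.complexConj L) N' 1 e₁ (Matrix.diagonal dV₁) JW
        (chiSplittingLine L e₁ dV₁ hdV₁ hdV₁0 (toHeckeCharacter L μ₀) (isUnitary_toHeckeCharacter L μ₀)
          (isSplittingChar_toHeckeCharacter_of_isConjugateSymplectic L μ₀ hμ₀) TW hWd JW hJW)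
        (CMCenter L dV₁ (archUnit L t), 1) Φ₀ = archWeight L m t • Φ₀)
    (h : ∀ t, pairRep (Fp L) L (IsCMField.complexConj L) N' 1 e₁ (Matrix.diagonal dV₁) JW s
        (CMCenter L dV₁ (archUnit L t), 1) Φ₀ = archWeight L m t • Φ₀) :
    ∃ (α : CMAdelicOne L →* ℂˣ) (hα : Continuous α)
      (hαrat : ∀ u : CMAdelicOne L, (u : ideleGroup L) ∈ principalIdeles L → α u = 1)
      (hαu : ∀ u, ‖((α u : ℂˣ) : ℂ)‖ = 1) (hμ : IsConjugateSymplectic L (twist L α hα hαrat μ₀)),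
      s = chiSplittingLine L e₁ dV₁ hdV₁ hdV₁0 (toHeckeCharacter L μ₀ * ratioHecke L α hα hαrat)
            (isUnitary_mul_ratioHecke L (isUnitary_toHeckeCharacter L μ₀) hα hαrat hαu)
            ((isSplittingChar_mul_ratioHecke_iff L 1 _ hα hαrat).2
              (isSplittingChar_toHeckeCharacter_of_isConjugateSymplectic L μ₀ hμ₀)) TW hWd JW hJW ∧
        toHeckeCharacter L (twist L α hα hαrat μ₀) = toHeckeCharacter L μ₀ * ratioHecke L α hα hαrat ∧
        HasWeight L (twist L α hα hαrat μ₀) 1 ∧ hμ.cmType = Φ := by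
  obtain ⟨α, hα, hαrat, hαu, hsα, h1, htw, hμ, -⟩ := exists_eq_chiSplittingLine_twist_of_center_eq L e₁ dV₁ hdV₁ hdV₁0 TW hW
    hWd JW hJW hA μ₀ hμ₀ hsc hs hΦ₀ h₀ h
  exact ⟨α, hα, hαrat, hαu, hμ, hsα, htw, hasWeight_twist_of_arch_eq_one L α hα hαrat μ₀ hw h1,
    hμ.cmType_eq (hasCMType_twist_of_arch_eq_one L α hα hαrat μ₀ hΦ h1)⟩

end General

/-! ## CM currency (`cmSplittingDatum`, `W = ⟨dW 0⟩`): one call for the COR-CM pin -/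

section CM

variable {N' n' : ℕ} (e₁ : Fin N' × Fin 1 ≃ Fin n')
  (dV₁ : Fin N' → L) (hdV₁ : ∀ i, IsCMField.complexConj L (dV₁ i) = dV₁ i) (hdV₁0 : ∀ i, dV₁ i ≠ 0)
  (dW : Fin 1 → L) (hdW : ∀ i, IsCMField.complexConj L (dW i) = dW i) (hdW0 : ∀ i, dW i ≠ 0)
  (μ₀ : IdeleClassGroup L →ₜ* Circle) (hμ₀ : IsConjugateSymplectic L μ₀)

set_option maxHeartbeats 2000000 in
/-- **THE (E)-REDUCTION, CM currency**: `exists_eq_chiSplittingLine_twist_weightOne_of_center_eq` at the tree's CM datum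
`cmSplittingDatum L e₁ dV dW` (`T_W := realDiagonal dW`, `J_W := diagonal dW`; `IsCompatible` in the shape of the COR-CM index
`LiuIndex.IsCompatAtScalar`, `dV := frameD V`, `dW := vec a`). [cite: Liu2021, Definition 4.3] [cite: GelbartRogawski1991, §3.1 Remark p. 457 L4–13] -/
theorem exists_eq_chiSplittingLine_twist_weightOne_of_center_eq_cm [NeZero N']
    (hA : CentralCharFactorsThroughDet (Fp L) L (IsCMField.complexConj L) N' 1 e₁ (Matrix.diagonal dV₁) (Matrix.diagonal dW)
      (det_reindex_kronecker_diagonal_line_ne_zero L e₁ dV₁ hdV₁0 (realDiagonal L dW hdW)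
        (isUnit_det_realDiagonal L dW hdW hdW0) (Matrix.diagonal dW) (realDiagonal_map L dW hdW).symm))
    (hw : HasWeight L μ₀ 1) {Φ : Literature.AlgebraicGeometry.Motives.CMType L} (hΦ : HasCMType L μ₀ Φ)
    {s : UnitaryGroup.adelicPair (Fp L) L (IsCMField.complexConj L) N' 1 (Matrix.diagonal dV₁) (Matrix.diagonal dW) →*
      adelicMpCont (Fp L) (Fin n') (adelicGram (Fp L) e₁ (realDiagonal L dV₁ hdV₁) (realDiagonal L dW hdW))}
    (hsc : Continuous s) (hs : (cmSplittingDatum L e₁ dV₁ hdV₁ hdV₁0 dW hdW hdW0).IsCompatible s)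
    {Φ₀ : piSchwartzBruhat (Fp L) (Fin n')} (hΦ₀ : Φ₀ ≠ 0) {m : InfinitePlace L → ℤ}
    (h₀ : ∀ t, pairRep (Fp L) L (IsCMField.complexConj L) N' 1 e₁ (Matrix.diagonal dV₁) (Matrix.diagonal dW)
        (chiSplittingLine L e₁ dV₁ hdV₁ hdV₁0 (toHeckeCharacter L μ₀) (isUnitary_toHeckeCharacter L μ₀)
          (isSplittingChar_toHeckeCharacter_of_isConjugateSymplectic L μ₀ hμ₀) (realDiagonal L dW hdW)
          (isUnit_det_realDiagonal L dW hdW hdW0) (Matrix.diagonal dW) (realDiagonal_map L dW hdW).symm)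
        (CMCenter L dV₁ (archUnit L t), 1) Φ₀ = archWeight L m t • Φ₀)
    (h : ∀ t, pairRep (Fp L) L (IsCMField.complexConj L) N' 1 e₁ (Matrix.diagonal dV₁) (Matrix.diagonal dW) s
        (CMCenter L dV₁ (archUnit L t), 1) Φ₀ = archWeight L m t • Φ₀) :
    ∃ (α : CMAdelicOne L →* ℂˣ) (hα : Continuous α)
      (hαrat : ∀ u : CMAdelicOne L, (u : ideleGroup L) ∈ principalIdeles L → α u = 1)
      (hαu : ∀ u, ‖((α u : ℂˣ) : ℂ)‖ = 1) (hμ : IsConjugateSymplectic L (twist L α hα hαrat μ₀)),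
      s = chiSplittingLine L e₁ dV₁ hdV₁ hdV₁0 (toHeckeCharacter L μ₀ * ratioHecke L α hα hαrat)
            (isUnitary_mul_ratioHecke L (isUnitary_toHeckeCharacter L μ₀) hα hαrat hαu)
            ((isSplittingChar_mul_ratioHecke_iff L 1 _ hα hαrat).2
              (isSplittingChar_toHeckeCharacter_of_isConjugateSymplectic L μ₀ hμ₀))
            (realDiagonal L dW hdW) (isUnit_det_realDiagonal L dW hdW hdW0) (Matrix.diagonal dW) (realDiagonal_map L dW hdW).symm ∧
        toHeckeCharacter L (twist L α hα hαrat μ₀) = toHeckeCharacter L μ₀ * ratioHecke L α hα hαrat ∧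
        HasWeight L (twist L α hα hαrat μ₀) 1 ∧ hμ.cmType = Φ :=
  exists_eq_chiSplittingLine_twist_weightOne_of_center_eq L e₁ dV₁ hdV₁ hdV₁0 (realDiagonal L dW hdW)
    (realDiagonal_isSymm L dW hdW) (isUnit_det_realDiagonal L dW hdW hdW0) (Matrix.diagonal dW) (realDiagonal_map L dW hdW).symm
    hA μ₀ hμ₀ hsc hs hΦ₀ hw hΦ h₀ h

end CM

end Literature.NumberTheory.Automorphic.Liu2021.Def411WeilCarriersDoubling

end
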